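import Literature.NumberTheory.GaloisRepresentations.IdeleClassInvariantNaturality
import HarnessLib

/-!
# `H²` of the idèle class formation is DIVISIBLE and EXHAUSTS `ℚ/ℤ` in the limit over finite Galois layers
# (Tate, C–F VII §11.2 (bis): `H²(Γ_F, C̄) = ⋃_E H²(Gal(E/F), C_E) ≅ ℚ/ℤ`)

Topic `NumberTheory/GaloisRepresentations`; namespace `Literature.NumberTheory.GaloisRepresentations.IdeleCohomology`
(sequel to door-c5 g15's `IdeleClassInvariant` / `IdeleClassInvariantNaturality`: `classInvAll F E : H²(Gal(E/F), C_E) ↪ ℚ/ℤ`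
with image `(1/[E:F])ℤ/ℤ`, `classInvAll_classInf : inv ∘ Inf = inv`).  Theorems only (no definition, no named fact, no
instance, no notation, no `sorry`); number fields in `Type`.

At a single finite layer `H²(Gal(E/F), C_E) ≅ (1/[E:F])ℤ/ℤ` is neither divisible nor all of `ℚ/ℤ`; in the LIMIT it is both,
because for every `N ≥ 1` there are finite Galois layers of degree divisible by `N` containing `E` (compositum of `E` with a
cyclic cyclotomic layer — tree `exists_isCyclic_dvd_finrank`, door-c4 g11's `isGalois_adjoin_image_bot`):

* §1 **`exists_galoisLayer_finrank_dvd`**: for every finite Galois `E/F` and `N ≥ 1` a finite Galois `M ⊆ Ē` over `F`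
  containing `E` with `N ∣ [M:F]`.
* §2 **`exists_classInvAll_eq_zmodToQmodZ`**: if `N ∣ [M:F]`, every element of `(1/N)ℤ/ℤ` is the invariant of a class of
  `H²(Gal(M/F), C_M)`; hence **`exists_layer_classInvAll_eq`**: EVERY `t ∈ ℚ/ℤ` is the invariant of a class of some finite
  Galois layer (the limit invariant map is onto `ℚ/ℤ`).
* §3 **`exists_layer_classInf_eq_nsmul`**: for every `x ∈ H²(Gal(E/F), C_E)` and `m ≥ 1` there are a finite Galois layer
  `M ⊇ E` and `y ∈ H²(Gal(M/F), C_M)` with `Inf x = m • y` (the limit group is divisible).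

USE (Route A (A5), crux `AnticycControlAdditiveK`, cell bsd-schneider): with door-c4 g14's `Extⁿ_{C_Γ}(k, M) = lim→ Extⁿ(Γ/U, M^U)`
these give `H²(Γ_F, C̄) ≅ ℚ/ℤ` (divisible), hence the `m`-torsion count `H²(U, C̄)[m] ≅ (1/m)ℤ/ℤ` (`α²(U, ℤ/m)`) and
the vanishing `Ext³_U(ℤ/m, C̄) = 0` from `H³ = 0`, two of the inputs of Milne I Thm. 1.8 (b).  HONEST FRAMING: classical; no case
of BSD / Poitou–Tate.

## References
* J. W. S. Cassels, A. Fröhlich (eds.), *Algebraic Number Theory* (1967), Ch. VII (J. Tate) §11.2 (bis), §10 Lemma.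
  [CasselsFrohlichANT1967]
* J. S. Milne, *Arithmetic Duality Theorems* (2006), I Thm. 1.8 (b) and its proof (the uses). [MilneADT2006]
-/

noncomputable section

open NumberField IsDedekindDomain CategoryTheory groupCohomology Function
open Literature.NumberTheory.Automorphic

namespace Literature.NumberTheory.GaloisRepresentations

namespace IdeleCohomology

open Literature.NumberTheory.NumberFields Literature.Algebra.Homology
open Literature.AnabelianGeometry.AbsoluteAnabelian.Prop121vii

/-! ## §1. Finite Galois layers of degree divisible by `N` containing a given layer -/

section Layer

variable (F E : Type) [Field F] [NumberField F] [Field E] [NumberField E] [Algebra F E] [IsGalois F E]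

/-- **For every `N ≥ 1` there is a finite Galois layer `M ⊇ E` (inside `Ē`) with `N ∣ [M:F]`**: the compositum of `E`
with a cyclic `L' ⊆ F̄` of degree divisible by `N` (tree `exists_isCyclic_dvd_finrank`; Galois over `F` by door-c4 g11's
`isGalois_adjoin_image_bot`), `[L':F] ∣ [M:F]`.
[cite: CasselsFrohlichANT1967, Ch. VII §10 Lemma, §11.2 (bis)] -/
theorem exists_galoisLayer_finrank_dvd {N : ℕ} (hN : N ≠ 0) :
    ∃ M : IntermediateField E (AlgebraicClosure E), FiniteDimensional E M ∧ IsGalois F M ∧ N ∣ Module.finrank F M := by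
  obtain ⟨L, hL, hgal, -, hdvd⟩ := exists_isCyclic_dvd_finrank F (n := N) hN
  haveI := hL
  haveI := hgal
  set M : IntermediateField E (AlgebraicClosure E) :=
    IntermediateField.adjoin E (absClosureEmbedding F E '' (L : Set (AlgebraicClosure F))) with hM
  haveI hfin : FiniteDimensional E M := finiteDimensional_adjoin_image (K := F) (L := E) L
  haveI hgalM : IsGalois F M := IdeleClassGroup.isGalois_adjoin_image_bot (F := F) (E := E) L
  refine ⟨M, hfin, hgalM, hdvd.trans ?_⟩
  -- `L → M` over `F`, so `[L:F] ∣ [M:F]`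
  let j : L →+* M :=
    { toFun := fun x => ⟨absClosureEmbedding F E (x : AlgebraicClosure F), IntermediateField.subset_adjoin E _ ⟨x, x.2, rfl⟩⟩
      map_one' := Subtype.ext (by simp)
      map_mul' := fun _ _ => Subtype.ext (by simp)
      map_zero' := Subtype.ext (by simp)
      map_add' := fun _ _ => Subtype.ext (by simp) }
  letI : Algebra L M := j.toAlgebra
  haveI : IsScalarTower F L M := IsScalarTower.of_algebraMap_eq fun x => Subtype.ext (by
    change algebraMap F (AlgebraicClosure E) x = absClosureEmbedding F E (algebraMap F (AlgebraicClosure F) x)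
    rw [AlgHom.commutes])
  haveI : FiniteDimensional F M := FiniteDimensional.trans F E M
  haveI : Module.Finite L M := Module.Finite.of_restrictScalars_finite F L M
  haveI : Module.Free L M := Module.Free.of_divisionRing L M
  exact ⟨Module.finrank L M, (Module.finrank_mul_finrank F L M).symm⟩

end Layer

/-! ## §2. Every element of `(1/N)ℤ/ℤ` — hence of `ℚ/ℤ` — is an invariant at a suitable layer -/

section Values

variable (F M : Type) [Field F] [NumberField F] [Field M] [NumberField M] [Algebra F M] [IsGalois F M]

/-- **If `N ∣ [M:F]`, every element of `(1/N)ℤ/ℤ` is `inv_{M/F}` of a class** (`range classInvAll = (1/[M:F])ℤ/ℤ ⊇ (1/N)ℤ/ℤ`).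
[cite: CasselsFrohlichANT1967, Ch. VII §11.2 (bis)] -/
theorem exists_classInvAll_eq_zmodToQmodZ {N : ℕ} [NeZero N] (hdvd : N ∣ Module.finrank F M) (t : ZMod N) :
    ∃ y : groupCohomology (IdeleClassGroup.galoisRep F M) 2, classInvAll F M y = zmodToQmodZ N t := by
  haveI := neZero_finrank F M
  have hmem : zmodToQmodZ N t ∈ Set.range (classInvAll F M) := by
    rw [range_classInvAll]
    refine UnitsLayer.mem_range_zmodToQmodZ_of_nsmul_eq_zero _ _ ?_
    obtain ⟨k, hk⟩ := hdvd
    rw [hk, mul_comm, mul_smul, UnitsLayer.nsmul_zmodToQmodZ, smul_zero]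
  exact hmem

omit [NumberField M] [IsGalois F M] in
/-- Every `t ∈ ℚ/ℤ` is killed by a positive integer (`t = a/b`, `b • t = 0`). [folklore] -/
private theorem exists_nsmul_eq_zero (t : AddCircle (1 : ℚ)) : ∃ N : ℕ, 0 < N ∧ N • t = 0 := by
  induction t using QuotientAddGroup.induction_on with
  | H q =>
    refine ⟨q.den, q.den_pos, ?_⟩
    change q.den • ((q : ℚ) : AddCircle (1 : ℚ)) = 0
    rw [← AddCircle.coe_nsmul, nsmul_eq_mul, Rat.den_mul_eq_num, ← zsmul_one, AddCircle.coe_zsmul,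
      AddCircle.coe_period, smul_zero]

/-- **Every `t ∈ ℚ/ℤ` is the invariant of a class of SOME finite Galois layer** (containing any given `E`): the limit
invariant map `H²(Γ_F, C̄) = ⋃_E H²(Gal(E/F), C_E) → ℚ/ℤ` is onto.
[cite: CasselsFrohlichANT1967, Ch. VII §11.2 (bis)] -/
theorem exists_layer_classInvAll_eq (E : Type) [Field E] [NumberField E] [Algebra F E] [IsGalois F E] (t : AddCircle (1 : ℚ)) :
    ∃ (M : IntermediateField E (AlgebraicClosure E)) (_ : FiniteDimensional E M) (_ : IsGalois F M) (_ : NumberField M),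
      ∃ y : groupCohomology (IdeleClassGroup.galoisRep F (M : Type)) 2, classInvAll F M y = t := by
  obtain ⟨N, hN, hNt⟩ := exists_nsmul_eq_zero t
  haveI : NeZero N := ⟨hN.ne'⟩
  obtain ⟨M', hfin, hgal, hdvd⟩ := exists_galoisLayer_finrank_dvd F E hN.ne'
  haveI := hfin
  haveI := hgal
  haveI : NumberField M' := NumberField.of_module_finite E M'
  obtain ⟨a, ha⟩ := UnitsLayer.mem_range_zmodToQmodZ_of_nsmul_eq_zero N t hNt
  obtain ⟨y, hy⟩ := exists_classInvAll_eq_zmodToQmodZ F M' hdvd a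
  exact ⟨M', hfin, hgal, inferInstance, y, hy.trans ha⟩

end Values

/-! ## §3. Divisibility in the limit: `Inf x = m • y` at a larger layer -/

section Divisible

variable (F E : Type) [Field F] [NumberField F] [Field E] [NumberField E] [Algebra F E] [IsGalois F E]

/-- `m • (((a k : ℕ)/N : ℚ)) = (a/n : ℚ)` in `ℚ/ℤ` when `N = n m k`. [folklore] -/
private theorem nsmul_coe_div_eq {n m k a : ℕ} (hn : n ≠ 0) (hm : m ≠ 0) (hk : k ≠ 0) :
    m • (((((a * k : ℕ) : ℚ)) / ((n * m * k : ℕ) : ℚ) : ℚ) : AddCircle (1 : ℚ)) =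
      ((((a : ℚ)) / n : ℚ) : AddCircle (1 : ℚ)) := by
  rw [← AddCircle.coe_nsmul, nsmul_eq_mul]
  congr 1
  have hn' : (n : ℚ) ≠ 0 := Nat.cast_ne_zero.2 hn
  have hm' : (m : ℚ) ≠ 0 := Nat.cast_ne_zero.2 hm
  have hk' : (k : ℚ) ≠ 0 := Nat.cast_ne_zero.2 hk
  push_cast
  field_simp

/-- **`H²` of the idèle class formation is divisible in the limit**: for every `x ∈ H²(Gal(E/F), C_E)` and `m ≥ 1` there are
a finite Galois layer `M ⊇ E` (inside `Ē`) and `y ∈ H²(Gal(M/F), C_M)` with `Inf x = m • y` (take `[M:F]` divisible by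
`m·[E:F]` and `y` the class of invariant `inv(x)/m`, well defined there; `inv ∘ Inf = inv` and injectivity of `inv_{M/F}`).
[cite: CasselsFrohlichANT1967, Ch. VII §11.2 (bis)][cite: MilneADT2006, I Thm. 1.8 (b) (proof)] -/
theorem exists_layer_classInf_eq_nsmul (x : groupCohomology (IdeleClassGroup.galoisRep F E) 2) {m : ℕ} (hm : 0 < m) :
    ∃ (M : IntermediateField E (AlgebraicClosure E)) (_ : FiniteDimensional E M) (_ : IsGalois F M) (_ : NumberField M),
      ∃ y : groupCohomology (IdeleClassGroup.galoisRep F (M : Type)) 2, classInf F E M 2 x = m • y := by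
  set n := Module.finrank F E with hn
  have hn0 : n ≠ 0 := Module.finrank_pos.ne'
  haveI : NeZero n := ⟨hn0⟩
  obtain ⟨M, hfin, hgal, hdvd⟩ := exists_galoisLayer_finrank_dvd F E (N := n * m) (mul_ne_zero hn0 hm.ne')
  haveI := hfin
  haveI := hgal
  haveI : NumberField M := NumberField.of_module_finite E M
  obtain ⟨k, hk⟩ := hdvd
  have hk0 : k ≠ 0 := fun h => Module.finrank_pos.ne' (by rw [hk, h, mul_zero])
  haveI : NeZero (Module.finrank F M) := neZero_finrank F M
  -- `inv(x) = a/n`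
  obtain ⟨a, ha⟩ : classInvAll F E x ∈ Set.range (zmodToQmodZ n) := by
    rw [← range_classInvAll]; exact ⟨x, rfl⟩
  -- the class `y` of `M/F` with invariant `a k / [M:F] = a/(n m)`
  obtain ⟨y, hy⟩ := exists_classInvAll_eq_zmodToQmodZ F M (dvd_refl _) ((a.val * k : ℕ) : ZMod (Module.finrank F M))
  refine ⟨M, hfin, hgal, inferInstance, y, classInvAll_injective F M ?_⟩
  rw [classInvAll_classInf, map_nsmul, hy, ← ha, zmodToQmodZ_apply, zmodToQmodZ_apply, ZMod.val_natCast,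
    Nat.mod_eq_of_lt (by
      rw [hk]
      calc a.val * k < n * k := Nat.mul_lt_mul_of_pos_right (ZMod.val_lt a) (Nat.pos_of_ne_zero hk0)
        _ ≤ n * m * k := Nat.mul_le_mul_right k (Nat.le_mul_of_pos_right n hm)),
    hk, nsmul_coe_div_eq hn0 hm.ne' hk0]

end Divisible

end IdeleCohomology

end Literature.NumberTheory.GaloisRepresentations

end
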